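import Literature.Computability.Complexity.PadEvaluation
import Literature.Computability.Complexity.RandomizedProofs
import Literature.Computability.Cryptography.IndistinguishabilityObfuscator

/-!
# `WbwObfuscatedGluedTrees` (stmt-QuantumAdvantage-2340) — line `knowledge-of-walk-split`: TOOLKIT I, total `FP` extensions of machines on codes

Helper file (generic complexity plumbing, no crux-specific content) for the line `knowledge-of-walk-split`
of crux `WbwObfuscatedGluedTrees` (route `WhiteBoxWalk`), lead prover-line-stmt-QuantumAdvantage-2340-0.

THE PROBLEM IT SOLVES. The tree's `PolyTimeComputable ea eb f` only constrains a machine on the IMAGE of the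
input encoder `ea` (off the image the machine may diverge), whereas the `FP` brick algebra
(`BrickAlgebra.lean`, `PlumbingBricks.lean`, …) composes TOTAL string functions.  Reductions that run a given
PPT adversary `A : RandAlg (List Bool) β` (`RandAlg.IsPolyTime`: a machine on `boolPair x r`), a given
efficient obfuscator (`CircuitObfuscator.IsEfficient`: a machine on `⟨⟨1^κ, code⟩, r⟩`) or a given
unary-poly-time schedule `κ` as SUBROUTINES of a new string program need them as total `FP` functions.

THE FIX (Arora–Barak 2009, Thm. 1.9 / §1.4.1, in the tree: the clocked universal interpreter
`ClockedUS.run`, `ClockedUS.Ufn ∈ FP`, `ClockedUS.sim`, file `ClockedUniversalSimulationProofs.lean`): run the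
machine's code word under the clocked universal machine with the budget `p_M(p(|x|))` and strip the
`optionBool` tag.  The resulting brick `extFn e Q` is total, lies in `FP`, and agrees with `eb ∘ f` on every
code `ea a` (`exists_FP_extension`).  Corollaries: `exists_FP_run` (a PPT `RandAlg` on strings as an `FP`
function of `⟨x, r⟩`), `exists_FP_runBool` (Boolean output), `exists_FP_unary` (a unary-poly-time `κ`),
`exists_FP_obf` (an efficient obfuscator on `⟨⟨1^κ, code C⟩, r⟩`), and the converse direction
`isPolyTime_of_FP` (an `FP` function of `⟨x, r⟩` with a polynomial coin bound is a PPT `RandAlg`).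
-/

set_option linter.dupNamespace false

noncomputable section

namespace Summit.QuantumAdvantage.QuantumAdvantage.Theorems.WbwObfuscatedGluedTrees.KnowledgeOfWalk

open Literature.Computability.Cryptography Literature.Computability.Complexity
open _root_.Computability Polynomial Brick Plumb

namespace FPExtension

/-- **The extension brick**: `x ↦ tail (Ufn ⟨⟨e, x⟩, 1^{Q(|x|)}⟩)` — run the machine coded by `e` on `x`
under the clocked universal machine with budget `Q(|x|)` and drop the `optionBool` tag.
[cite: AroraBarakCC2009, Thm. 1.9 and §1.4.1] -/
def extFn (e : List Bool) (Q : Polynomial ℕ) : List Bool → List Bool :=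
  dropFn ∘ fanoutFn (fun _ => [true])
    (ClockedUS.Ufn ∘ fanoutFn (fanoutFn (fun _ => e) (fun w => w)) (polyFn Q))

/-- `extFn e Q ∈ FP`. [cite: AroraBarakCC2009, Thm. 1.9] -/
theorem extFn_mem_FP (e : List Bool) (Q : Polynomial ℕ) : extFn e Q ∈ FP :=
  comp_mem_FP dropFn_mem_FP (fanoutFn_mem_FP (const_mem_FP _)
    (comp_mem_FP ClockedUS.Ufn_mem_FP
      (fanoutFn_mem_FP (fanoutFn_mem_FP (const_mem_FP _) ClockedUA.id_mem_FP) (polyFn_mem_FP Q))))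

/-- Unary numerals are blocks of `1`s. [folklore] -/
theorem unaryEncodeNat_eq_ones : ∀ n : ℕ, unaryEncodeNat n = ones n
  | 0 => rfl
  | n + 1 => by simp [unaryEncodeNat, ones, List.replicate_succ, unaryEncodeNat_eq_ones n]

/-- **Value of the brick** when the coded machine answers `y` on `x` within the budget `Q(|x|)`.
[folklore] -/
theorem extFn_apply_of_run {e x y : List Bool} {Q : Polynomial ℕ}
    (h : ClockedUS.run (boolPair e x) (Q.eval x.length) = some y) : extFn e Q x = y := by
  have hU : ClockedUS.Ufn (boolPair (boolPair e x) (unaryEncodeNat (Q.eval x.length))) = true :: y := by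
    rw [ClockedUS.Ufn_apply, h]; rfl
  have hQ : polyFn Q x = unaryEncodeNat (Q.eval x.length) := by
    rw [polyFn_apply, unaryEncodeNat_eq_ones]
  simp only [extFn, Function.comp_apply, fanoutFn_apply, hQ, hU, dropFn_boolPair, List.length_singleton,
    List.drop_one, List.tail_cons]

/-- **Machines on codes extend to total `FP` functions.**  If `f : α → β` is polynomial-time computable
w.r.t. Boolean encoders `ea`, `eb`, then some TOTAL `F ∈ FP` satisfies `F (ea a) = eb (f a)` for every `a`
(nothing is claimed off the image of `ea`).  Proof: clock the machine under the universal interpreter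
(`ClockedUS.sim`) with budget `p_M(p(|ea a|))`. [cite: AroraBarakCC2009, Thm. 1.9 and §1.4.1] -/
theorem exists_FP_extension {α β : Type} {ea : α → List Bool} {eb : β → List Bool} {f : α → β}
    (hf : PolyTimeComputable ea eb f) : ∃ F ∈ FP, ∀ a, F (ea a) = eb (f a) := by
  obtain ⟨p, M, hM⟩ := hf
  refine ⟨extFn (ClockedUS.ecode M) ((ClockedUA.pM M).comp p), extFn_mem_FP _ _, fun a => ?_⟩
  apply extFn_apply_of_run
  rw [Polynomial.eval_comp]
  exact ClockedUS.sim M (hM a)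

/-- **A PPT adversary on strings as an `FP` function of `⟨x, r⟩`.**  For `A : RandAlg (List Bool) (List Bool)`
with `IsPPT A id` there is `R ∈ FP` with `R ⟨x, r⟩ = A.run x r` for all `x, r`. [folklore] -/
theorem exists_FP_run {A : RandAlg (List Bool) (List Bool)} (hA : IsPPT A id) :
    ∃ R ∈ FP, ∀ x r : List Bool, R (boolPair x r) = A.run x r := by
  obtain ⟨R, hR, h⟩ := exists_FP_extension hA.1
  exact ⟨R, hR, fun x r => h (x, r)⟩

/-- The same for a Boolean-output PPT `D` (`IsPPT D encodeBool`): `R ⟨x, r⟩ = encodeBool (D.run x r)`.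
[folklore] -/
theorem exists_FP_runBool {D : RandAlg (List Bool) Bool} (hD : IsPPT D encodeBool) :
    ∃ R ∈ FP, ∀ x r : List Bool, R (boolPair x r) = encodeBool (D.run x r) := by
  obtain ⟨R, hR, h⟩ := exists_FP_extension hD.1
  exact ⟨R, hR, fun x r => h (x, r)⟩

/-- **A unary-poly-time schedule as an `FP` function**: `K (1ⁿ) = 1^{κ n}`. [folklore] -/
theorem exists_FP_unary {κ : ℕ → ℕ} (hκ : PolyTimeComputable unaryEncodeNat unaryEncodeNat κ) :
    ∃ K ∈ FP, ∀ n, K (unaryEncodeNat n) = unaryEncodeNat (κ n) :=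
  exists_FP_extension hκ

/-- **An efficient obfuscator as an `FP` function of `⟨⟨1^κ, code C⟩, r⟩`**:
`Ob ⟨⟨1^κ, encodeSizedCircuit ⟨n, C⟩⟩, r⟩ = encodeSizedCircuit ⟨n, O.obf κ C r⟩`. [folklore] -/
theorem exists_FP_obf {O : CircuitObfuscator} (hO : O.IsEfficient) :
    ∃ Ob ∈ FP, ∀ (κ n : ℕ) (C : Circuit (Fin n)) (r : List Bool),
      Ob (boolPair (boolPair (unaryEncodeNat κ) (encodeSizedCircuit ⟨n, C⟩)) r) =
        encodeSizedCircuit ⟨n, O.obf κ C r⟩ := by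
  obtain ⟨Ob, hOb, h⟩ := exists_FP_extension hO.1
  exact ⟨Ob, hOb, fun κ n C r => h ((κ, ⟨n, C⟩), r)⟩

/-- **Converse: an `FP` string program is a PPT `RandAlg`.**  If `F ∈ FP` computes `A.run` on pairs,
`F ⟨x, r⟩ = eb (A.run x r)`, and the coin budget is polynomially bounded, then `A.IsPolyTime id eb`.
[folklore] -/
theorem isPolyTime_of_FP {β : Type} {A : RandAlg (List Bool) β} {eb : β → List Bool} {F : List Bool → List Bool}
    (hF : F ∈ FP) (hrun : ∀ x r, F (boolPair x r) = eb (A.run x r))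
    (hcoin : ∃ p : Polynomial ℕ, ∀ n, A.coinLen n ≤ p.eval n) : A.IsPolyTime id eb :=
  ⟨PolyTimeComputable.of_encode_eq (f := F) (ea := id) (eb := id)
      (fun p : List Bool × List Bool => boolPair p.1 p.2) (fun _ => rfl) (fun p => hrun p.1 p.2) hF,
    hcoin⟩

/-- An `FP` function has polynomially bounded output length (re-export of
`exists_poly_length_le_of_mem_FP` under this namespace, for the stub files). [folklore] -/
theorem exists_poly_length_le {f : List Bool → List Bool} (hf : f ∈ FP) :
    ∃ q : Polynomial ℕ, ∀ x, (f x).length ≤ q.eval x.length :=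
  exists_poly_length_le_of_mem_FP hf

end FPExtension

/-- Registered helper stub of crux stmt-QuantumAdvantage-2340 (closed form of `FPExtension.exists_FP_extension`): machines on codes extend to total `FP` functions. [cite: AroraBarakCC2009, Thm. 1.9 and §1.4.1] -/
theorem toolkit_fpExtension :
    ∀ (α β : Type) (ea : α → List Bool) (eb : β → List Bool) (f : α → β), PolyTimeComputable ea eb f → ∃ F ∈ FP, ∀ a, F (ea a) = eb (f a) :=
  fun _ _ _ _ _ hf => FPExtension.exists_FP_extension hf

end Summit.QuantumAdvantage.QuantumAdvantage.Theorems.WbwObfuscatedGluedTrees.KnowledgeOfWalk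

end
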